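import Summits.ResolutionOfSingularities.ResolutionOfSingularities.Theorems.EquisingularLiftCampaignW45bULT
import Literature.AlgebraicGeometry.Resolution.Temkin2008Localization
import HarnessLib

/-!
# [OURS · L1 W4.5(b)] Lemma V, persistence half — the REPAIRED positive helper (proofs only)

Cell res-hironaka (LADDER-RESOLUTION rung L, D-0089), slot W4.5(b), crux EL♮ `EquisingularLiftNat`
(stmt-ResolutionOfSingularities-20038); `--supports … --as helper`. Prover res-type-100 (gen 9) on
res-L1-w45b-plan-1's GO 2026-08-27T05:07:35Z («`SpecialFibreReduciblePersists n`: TRUE and nearly free — … a one-screen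
helper for any idle prover») and res-L1-type-o1's typing `EquisingularLift.SpecialFibreReduciblePersists` (p499585, §4).

WHAT IS PROVED. For a blow-up `τ : X″ → X′` (tree `Resolution.IsBlowup`, the universal property) of an INTEGRAL and
LOCALLY NOETHERIAN scheme `X′` along any ideal sheaf `C`:
* `EquisingularLift.surjective_of_isBlowup` — if `C ≠ 0` then `τ` is surjective (proper by `IsBlowup.isProper`
  [Stacks 02NS], dominant because `τ` is an isomorphism over `X′ ∖ Supp C ∋ η_{X′}` [Stacks 02OS, `IsBlowup.isIso_compl`],
  and proper dominant morphisms are surjective, Mathlib `Surjective.of_universallyClosed_of_isDominant`);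
* `EquisingularLift.not_isIrreducible_preimage_of_isBlowup` — for EVERY subset `S ⊆ X′`: if `S` is not irreducible then
  neither is `τ⁻¹ S` (`C = 0` gives `X″ = ∅`, tree `IsBlowup.isEmpty_of_bot`; otherwise `S = τ(τ⁻¹S)` is a continuous image);
* `EquisingularLift.specialFibreReduciblePersists_of_isLocallyNoetherian` — the text of the typed Prop
  `SpecialFibreReduciblePersists n` (§4 of `…CampaignW45bULT.lean`) with ONE extra hypothesis `IsLocallyNoetherian X′`
  inserted after `IsIntegral X′`, PROVED. Every stage `X′` of the EL♮ / ULT chains is a blow-up of a blow-up … of `ℙⁿ_O`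
  along coherent ideal sheaves, hence of finite type over the DVR `O` and locally Noetherian, so this is the form the
  first-touch / lemma-V argument consumes.

WHY THE EXTRA HYPOTHESIS. As typed, `SpecialFibreReduciblePersists n` quantifies over ALL integral `X′` over `ℙⁿ_O` with no
finiteness, and blow-ups of non-Noetherian integral schemes along non-finite-type ideals need not be surjective (the blow-up
along an idempotent ideal sheaf `C = C²` is the open immersion `X′ ∖ Supp C ↪ X′`); the companion file
`…ULTSpecialFibrePersistsNegative.lean` (this seat) records the kernel witness. Nothing here is a statement of
H. Hironaka's manuscript; no `Literature.…` fact about resolution is used beyond the tree's blow-up library.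
AI-written; AI review is weaker than expert review. [Hironaka2017] — scope only.
-/

noncomputable section

set_option linter.dupNamespace false -- mandated namespace of this single-conjunct summit

open CategoryTheory AlgebraicGeometry TopologicalSpace Topology
open Literature.AlgebraicGeometry.Resolution

namespace Summit.ResolutionOfSingularities.ResolutionOfSingularities.Theorems

namespace EquisingularLift

universe u

/-! ## Two structural facts about blow-ups -/

/-- On an integral scheme the generic point is off the support of a non-zero ideal sheaf. [folklore] -/
theorem genericPoint_notMem_support_of_ne_bot {X : Scheme.{u}} [IsIntegral X] {K : X.IdealSheafData} (hK : K ≠ ⊥) :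
    genericPoint X ∉ K.support := by
  intro h
  apply hK
  rw [← Scheme.IdealSheafData.support_eq_top_iff, ← top_le_iff]
  intro x _
  have := (genericPoint_spec X).mem_closed_set_iff K.support.isClosed
  exact (this.mp h) (Set.mem_univ x)

/-- **A blow-up of a locally Noetherian integral scheme along a non-zero ideal sheaf is surjective**: it is proper
(Stacks 02NS, tree `IsBlowup.isProper`) and dominant (an isomorphism over the complement of the centre, which contains
the generic point; Stacks 02OS, tree `IsBlowup.isIso_compl`), and proper dominant morphisms are surjective.
[cite: StacksProject, Tag 02NS and Tag 02OS] -/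
theorem surjective_of_isBlowup {X' X'' : Scheme.{u}} [IsIntegral X'] [IsLocallyNoetherian X'] {C : X'.IdealSheafData}
    {τ : X'' ⟶ X'} (hτ : IsBlowup τ C) (hC : C ≠ ⊥) : Function.Surjective τ := by
  set W₀ : X'.Opens := ⟨(C.support : Set X')ᶜ, C.support.isClosed.isOpen_compl⟩ with hW₀
  haveI : IsIso (τ ∣_ W₀) := hτ.isIso_compl
  have hηW : genericPoint X' ∈ W₀ := genericPoint_notMem_support_of_ne_bot hC
  obtain ⟨ξ', hξ'⟩ := (ConcreteCategory.bijective_of_isIso ((τ ∣_ W₀).base)).2 ⟨genericPoint X', hηW⟩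
  have hτξ' : τ ξ'.1 = genericPoint X' := by
    have := congrArg Subtype.val hξ'
    rwa [morphismRestrict_base_coe] at this
  haveI : IsProper τ := hτ.isProper
  haveI : IsDominant τ := ⟨Dense.mono
    (show ({genericPoint X'} : Set X') ⊆ Set.range τ by rintro _ rfl; exact ⟨ξ'.1, hτξ'⟩)
    (by rw [dense_iff_closure_eq, genericPoint_closure])⟩
  haveI : Surjective τ := inferInstance
  exact τ.surjective

/-- **Persistence of non-irreducibility along blow-ups of locally Noetherian integral schemes.** For a blow-up
`τ : X″ → X′` of an integral, locally Noetherian `X′` along any ideal sheaf `C` and every subset `S ⊆ X′`: if `S` is not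
irreducible (reducible or empty), then `τ⁻¹ S` is not irreducible. (If `C = 0` then `X″ = ∅`; otherwise `τ` is surjective
and `S = τ(τ⁻¹ S)` would be the continuous image of an irreducible set.) [folklore] -/
theorem not_isIrreducible_preimage_of_isBlowup {X' X'' : Scheme.{u}} [IsIntegral X'] [IsLocallyNoetherian X']
    {C : X'.IdealSheafData} {τ : X'' ⟶ X'} (hτ : IsBlowup τ C) {S : Set X'} (hS : ¬ IsIrreducible S) :
    ¬ IsIrreducible (τ ⁻¹' S) := by
  intro hirr
  by_cases hC : C = ⊥
  · subst hC
    haveI := hτ.isEmpty_of_bot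
    obtain ⟨x, -⟩ := hirr.nonempty
    exact IsEmpty.false x
  · apply hS
    have hsurj := surjective_of_isBlowup hτ hC
    rw [← Set.image_preimage_eq S hsurj]
    exact hirr.image _ τ.base.hom.continuous.continuousOn

/-! ## The typed Prop with the finiteness hypothesis, proved -/

/-- [OURS · L1 W4.5(b)] replaces the role of NOTHING in the manuscript; NOT a statement of the manuscript. **LEMMA V,
PERSISTENCE HALF, for LOCALLY NOETHERIAN `X′` — PROVED.** The text of res-L1-type-o1's `SpecialFibreReduciblePersists n`
(`…CampaignW45bULT.lean` §4, p499585) with the single extra hypothesis `IsLocallyNoetherian X′` inserted after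
`IsIntegral X′`: for every DVR `O`, all `X′ X″` over `P = ℙⁿ_O` with `X′` integral and locally Noetherian, every ideal sheaf
`C` on `X′` and every blow-up `τ : X″ → X′` along `C`, if the special fibre of `X′` over the closed point `s₀` of `Spec O`
is not irreducible then neither is that of `X″`. Immediate from `not_isIrreducible_preimage_of_isBlowup` (the special
fibre of `X″` is the preimage of that of `X′`). Every stage of the EL♮ / ULT chains (iterated blow-ups of `ℙⁿ_O` along
coherent ideals) is locally Noetherian, so this is the form lemma V is consumed in. [folklore] -/
theorem specialFibreReduciblePersists_of_isLocallyNoetherian (n : ℕ) (O : Type) [CommRing O] [IsDomain O]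
    [IsDiscreteValuationRing O] :
    letI := MvPolynomial.gradedAlgebra (σ := Fin (n + 1)) (R := O)
    ∀ (X' X'' : AlgebraicGeometry.Scheme.{0})
      (σ' : X' ⟶ (AlgebraicGeometry.Proj (MvPolynomial.homogeneousSubmodule (Fin (n + 1)) O)))
      (C : X'.IdealSheafData) (τ : X'' ⟶ X'), AlgebraicGeometry.IsIntegral X' → IsLocallyNoetherian X' →
      Literature.AlgebraicGeometry.Resolution.IsBlowup τ C →
      ¬ IsIrreducible ((CategoryTheory.CategoryStruct.comp σ' (CategoryTheory.CategoryStruct.comp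
        (AlgebraicGeometry.Proj.toSpecZero (MvPolynomial.homogeneousSubmodule (Fin (n + 1)) O))
        (AlgebraicGeometry.Spec.map (CommRingCat.ofHom (algebraMap O
          (MvPolynomial.homogeneousSubmodule (Fin (n + 1)) O 0)))))) ⁻¹' {IsLocalRing.closedPoint O}) →
      ¬ IsIrreducible ((CategoryTheory.CategoryStruct.comp (CategoryTheory.CategoryStruct.comp τ σ')
        (CategoryTheory.CategoryStruct.comp
        (AlgebraicGeometry.Proj.toSpecZero (MvPolynomial.homogeneousSubmodule (Fin (n + 1)) O))
        (AlgebraicGeometry.Spec.map (CommRingCat.ofHom (algebraMap O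
          (MvPolynomial.homogeneousSubmodule (Fin (n + 1)) O 0)))))) ⁻¹' {IsLocalRing.closedPoint O}) := by
  intro X' X'' σ' C τ hX' hN hτ hF hirr
  refine not_isIrreducible_preimage_of_isBlowup hτ hF ?_
  convert hirr using 1
  ext x
  simp only [Set.mem_preimage, Scheme.Hom.comp_apply]

end EquisingularLift

end Summit.ResolutionOfSingularities.ResolutionOfSingularities.Theorems

end
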